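import Literature.Geometry.Manifold.StabilityOfEmbeddings
import Literature.Geometry.Manifold.InverseFunctionTheorem
import Mathlib.Geometry.Manifold.MFDeriv.SpecificFunctions
import HarnessLib

/-!
# The transversal thickening of an immersion is an immersion near the zero section

Topic `Literature/Topology/Immersions`. The first step of Poenaru's pleating lemma in Gromov,
*Partial Differential Relations* (1986), §2.1.3 (C), p. 57 ("there obviously exist an immersion
`I : V₀ × ℝ → W` … with `I ∘ F̃ = F`"), which is also the classical passage from a codimension-one
immersion with a transversal field to an equidimensional immersion of a product neighbourhood
(Hirsch, *Differential Topology*, Ch. 4, §5, tubular neighbourhoods of immersions; the openness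
of the immersion condition is Ch. 2 §1, Thm. 1.1): for a `C^n` map `f : V → F'` (`n ≥ 1`) of a
COMPACT boundaryless manifold into a normed space and a `C^n` field `ν : V → F'` with `ν(v)` never
in the image of `df_v`, the **thickening** `Θ(v, s) = f(v) + s ν(v)` on `V × ℝ` has injective
differential at every `(v, s)` with `|s| < ε`, for some `ε > 0` — provided each `df_v` is
injective. Proof as printed/folklore: at `s = 0`,
`dΘ_{(v,0)}(w, σ) = df_v(w) + σ ν(v)` is injective (transversality); injectivity of the
differential is an open condition (the tree's parametric form of Hirsch's Lemma 1.3,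
`Literature.Geometry.Manifold.exists_isOpen_eventually_injOn_and_injective_mfderiv`, used with a
dummy parameter); the tube lemma over the compact `V × {0}` gives a uniform `ε`.

* `contMDiff_thickening` — `Θ` is `C^n` on `V × ℝ`;
* `mfderiv_thickening_zero_apply` — the differential of `Θ` along the zero section;
* `injective_mfderiv_thickening_zero` — it is injective when `df_v` is and `ν v ∉ im df_v`;
* `isOpen_setOf_injective_mfderiv` — for a `C^n` map (`n ≥ 1`) from a boundaryless manifold over
  a finite-dimensional model into a normed space, `{x | dg_x injective}` is open (Hirsch Thm. 1.1,
  pointwise form);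
* `exists_pos_forall_injective_mfderiv_thickening` — **the thickening is an immersion on
  `V × (-ε, ε)`** (`V` compact);
* `exists_pos_forall_isLocalDiffeomorphAt_thickening` — in the equidimensional case
  `dim F' = dim V + 1` (a hypersurface with a transversal field, Gromov's `I : V₀ × ℝ → W`) the
  thickening is a `C^n` local diffeomorphism at every point of `V × (-ε, ε)` (the tree's inverse
  function theorem on manifolds, `Literature.Geometry.Manifold.isLocalDiffeomorphAt_of_mfderiv`).

Everything is proved; theorems only (the thickening is written out, no definition is introduced).
This is infrastructure for piece E5 (Gromov (C)/(D)) of the programme around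
`Literature.Topology.FourManifolds.eliashberg_foldMap_homotopySphere_four`
(`HomotopyS4FoldMapProofs.lean`).

## References

* M. Gromov, *Partial Differential Relations* (1986), §2.1.3 (C), p. 57. [Gromov1986]
* M. W. Hirsch, *Differential Topology*, GTM 33 (1976), Ch. 2 §1 Thm. 1.1; Ch. 4 §5.
  [HirschDT1976]
-/

noncomputable section

open Set Function Filter Metric
open scoped Manifold ContDiff Topology

namespace Literature.Topology.Immersions

variable {E : Type*} [NormedAddCommGroup E] [NormedSpace ℝ E]
  {H : Type*} [TopologicalSpace H] {I : ModelWithCorners ℝ E H}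
  {V : Type*} [TopologicalSpace V] [ChartedSpace H V]
  {F' : Type*} [NormedAddCommGroup F'] [NormedSpace ℝ F']
  {n : WithTop ℕ∞}

/-- The thickening `Θ(v, s) = f(v) + s ν(v)` of a `C^n` map by a `C^n` field is `C^n` on the
product manifold `V × ℝ`. [folklore] -/
theorem contMDiff_thickening {f ν : V → F'} (hf : ContMDiff I 𝓘(ℝ, F') n f)
    (hν : ContMDiff I 𝓘(ℝ, F') n ν) :
    ContMDiff (I.prod 𝓘(ℝ, ℝ)) 𝓘(ℝ, F') n fun q : V × ℝ => f q.1 + q.2 • ν q.1 :=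
  (hf.comp contMDiff_fst).add
    ((contMDiff_snd (I := I) (J := 𝓘(ℝ, ℝ)) (M := V) (N := ℝ)).smul (hν.comp contMDiff_fst))

/-- **The differential of the thickening along the zero section**:
`dΘ_{(v,0)}(w, σ) = df_v(w) + σ ν(v)` (the differentials read as maps of the model spaces,
`E × ℝ →L F'` and `E →L F'`). [folklore] -/
theorem mfderiv_thickening_zero_apply [IsManifold I 1 V] {f ν : V → F'}
    (hf : ContMDiff I 𝓘(ℝ, F') 1 f) (hν : ContMDiff I 𝓘(ℝ, F') 1 ν) (v : V) (w : E × ℝ) :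
    (id (mfderiv (I.prod 𝓘(ℝ, ℝ)) 𝓘(ℝ, F') (fun q : V × ℝ => f q.1 + q.2 • ν q.1) (v, 0)) :
        E × ℝ →L[ℝ] F') w =
      (id (mfderiv I 𝓘(ℝ, F') f v) : E →L[ℝ] F') w.1 + w.2 • ν v := by
  have hΘ : MDifferentiableAt (I.prod 𝓘(ℝ, ℝ)) 𝓘(ℝ, F')
      (fun q : V × ℝ => f q.1 + q.2 • ν q.1) (v, 0) :=
    (contMDiff_thickening hf hν).mdifferentiableAt one_ne_zero
  have key := mfderiv_prod_eq_add_apply (v := w) hΘ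
  -- the slice `z ↦ f z + 0 • ν z` is `f`
  have h1 : (fun z : V => f z + (0 : ℝ) • ν z) = f := by
    funext z
    simp
  -- the slice `s ↦ f v + s • ν v` is affine in `s`
  have hd : HasMFDerivAt 𝓘(ℝ, ℝ) 𝓘(ℝ, F') (fun s : ℝ => f v + s • ν v) 0
      ((ContinuousLinearMap.id ℝ ℝ).smulRight (ν v)) := by
    rw [hasMFDerivAt_iff_hasFDerivAt]
    exact ((hasFDerivAt_id (0 : ℝ)).smul_const (ν v)).const_add (f v)
  have h2 : (id (mfderiv 𝓘(ℝ, ℝ) 𝓘(ℝ, F') (fun s : ℝ => f v + s • ν v) 0) : ℝ →L[ℝ] F') w.2 =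
      w.2 • ν v := by
    rw [hd.mfderiv]
    rfl
  have h1' : (id (mfderiv I 𝓘(ℝ, F') (fun z : V => f z + (0 : ℝ) • ν z) v) : E →L[ℝ] F') w.1 =
      (id (mfderiv I 𝓘(ℝ, F') f v) : E →L[ℝ] F') w.1 := by
    rw [h1]
  rw [← h1', ← h2]
  exact key

/-- **Transversal thickenings are immersive along the zero section**: if `df_v` is injective and
`ν(v)` is not in its image, then `dΘ_{(v,0)}` is injective. [folklore] -/
theorem injective_mfderiv_thickening_zero [IsManifold I 1 V] {f ν : V → F'}
    (hf : ContMDiff I 𝓘(ℝ, F') 1 f) (hν : ContMDiff I 𝓘(ℝ, F') 1 ν) {v : V}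
    (hfi : Injective (mfderiv I 𝓘(ℝ, F') f v))
    (hνt : ∀ w : TangentSpace I v, mfderiv I 𝓘(ℝ, F') f v w ≠ ν v) :
    Injective (mfderiv (I.prod 𝓘(ℝ, ℝ)) 𝓘(ℝ, F') (fun q : V × ℝ => f q.1 + q.2 • ν q.1)
      (v, 0)) := by
  let L : E →L[ℝ] F' := mfderiv I 𝓘(ℝ, F') f v
  let M : E × ℝ →L[ℝ] F' :=
    mfderiv (I.prod 𝓘(ℝ, ℝ)) 𝓘(ℝ, F') (fun q : V × ℝ => f q.1 + q.2 • ν q.1) (v, 0)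
  have hLi : Injective L := hfi
  have hνt' : ∀ w : E, L w ≠ ν v := hνt
  have hML : ∀ w : E × ℝ, M w = L w.1 + w.2 • ν v := mfderiv_thickening_zero_apply hf hν v
  suffices hM : Injective M from hM
  refine (injective_iff_map_eq_zero M).2 fun w hw => ?_
  have hw' : L w.1 + w.2 • ν v = 0 := (hML w).symm.trans hw
  -- `L w.1 = -w.2 • ν v`; transversality forces `w.2 = 0`, then injectivity gives `w.1 = 0`
  have h2 : w.2 = 0 := by
    by_contra h
    have key2 : L w.1 = (-w.2) • ν v := by
      rw [neg_smul, eq_neg_iff_add_eq_zero]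
      exact hw'
    have : L ((-w.2)⁻¹ • w.1) = ν v := by
      rw [L.map_smul, key2, smul_smul, inv_mul_cancel₀ (neg_ne_zero.mpr h), one_smul]
    exact hνt' _ this
  have h1 : w.1 = 0 := by
    rw [h2, zero_smul, add_zero] at hw'
    exact (injective_iff_map_eq_zero L).1 hLi w.1 hw'
  exact Prod.ext h1 h2

/-- **The immersion condition is open** (Hirsch, Ch. 2 §1, Thm. 1.1, pointwise): for a `C^n` map
(`n ≥ 1`) from a boundaryless manifold over a finite-dimensional model into a normed space, the
set of points where the differential is injective is open (the tree's parametric Lemma 1.3,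
`exists_isOpen_eventually_injOn_and_injective_mfderiv`, with a dummy parameter).
[cite: HirschDT1976, Ch. 2 §1 Thm. 1.1] -/
theorem isOpen_setOf_injective_mfderiv [I.Boundaryless] [IsManifold I n V]
    [FiniteDimensional ℝ E] {g : V → F'} (hg : ContMDiff I 𝓘(ℝ, F') n g) (hn : 1 ≤ n) :
    IsOpen {x : V | Injective (mfderiv I 𝓘(ℝ, F') g x)} := by
  rw [isOpen_iff_forall_mem_open]
  intro x₀ hx₀
  -- the family `Φ p x = g x`, constant in the dummy parameter `p : ℝ`
  have hΦ : ContMDiffOn (𝓘(ℝ, ℝ).prod I) 𝓘(ℝ, F') n (uncurry fun (_ : ℝ) (x : V) => g x)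
      ((univ : Set ℝ) ×ˢ (univ : Set V)) :=
    (hg.comp contMDiff_snd).contMDiffOn
  obtain ⟨N, hNo, hxN, hev⟩ :=
    Literature.Geometry.Manifold.exists_isOpen_eventually_injOn_and_injective_mfderiv
      (J := 𝓘(ℝ, ℝ)) (I := I) isOpen_univ hΦ hn (p₀ := (0 : ℝ)) (mem_univ _) x₀ hx₀
  exact ⟨N, fun x hx => (hev.self_of_nhds).2 x hx, hNo, hxN⟩

/-- **The transversal thickening of an immersion of a compact manifold is an immersion near the
zero section** (Gromov PDR §2.1.3 (C), first sentence of the proof, for `W` a vector space;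
Hirsch Ch. 4 §5): for `V` compact boundaryless over a finite-dimensional model, `f, ν : V → F'`
of class `C^n` (`n ≥ 1`) with every `df_v` injective and `ν(v) ∉ im df_v`, there is `ε > 0` such
that `Θ(v, s) = f(v) + s ν(v)` has injective differential at every `(v, s)` with `|s| < ε`.
[cite: Gromov1986, §2.1.3 (C) p. 57] -/
theorem exists_pos_forall_injective_mfderiv_thickening [I.Boundaryless] [IsManifold I n V]
    [FiniteDimensional ℝ E] [CompactSpace V] {f ν : V → F'} (hf : ContMDiff I 𝓘(ℝ, F') n f)
    (hν : ContMDiff I 𝓘(ℝ, F') n ν) (hn : 1 ≤ n)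
    (hfi : ∀ v, Injective (mfderiv I 𝓘(ℝ, F') f v))
    (hνt : ∀ (v : V) (w : TangentSpace I v), mfderiv I 𝓘(ℝ, F') f v w ≠ ν v) :
    ∃ ε > 0, ∀ q : V × ℝ, |q.2| < ε →
      Injective (mfderiv (I.prod 𝓘(ℝ, ℝ)) 𝓘(ℝ, F') (fun q : V × ℝ => f q.1 + q.2 • ν q.1) q) := by
  haveI : IsManifold I 1 V := IsManifold.of_le hn
  set U : Set (V × ℝ) := {q | Injective (mfderiv (I.prod 𝓘(ℝ, ℝ)) 𝓘(ℝ, F')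
    (fun q : V × ℝ => f q.1 + q.2 • ν q.1) q)} with hU
  have hUo : IsOpen U :=
    isOpen_setOf_injective_mfderiv (I := I.prod 𝓘(ℝ, ℝ)) (contMDiff_thickening hf hν) hn
  have h0 : (univ : Set V) ×ˢ ({0} : Set ℝ) ⊆ U := by
    rintro ⟨v, s⟩ ⟨-, hs⟩
    rw [mem_singleton_iff] at hs
    subst hs
    exact injective_mfderiv_thickening_zero (hf.of_le hn) (hν.of_le hn) (hfi v) (hνt v)
  obtain ⟨u, w, -, hwo, huniv, h0w, huw⟩ :=
    generalized_tube_lemma isCompact_univ isCompact_singleton hUo h0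
  obtain ⟨ε, hε, hεw⟩ := Metric.isOpen_iff.mp hwo 0 (h0w (mem_singleton 0))
  refine ⟨ε, hε, fun q hq => huw ⟨huniv (mem_univ q.1), hεw ?_⟩⟩
  simpa [Real.dist_eq] using hq

/-- **The equidimensional case: the thickening of an immersed hypersurface with a transversal
field is a local diffeomorphism near the zero section** (Gromov PDR §2.1.3 (C), the immersion
`I : V₀ × ℝ → W`, `dim W = dim V₀ + 1`, for `W` a vector space): with `V` compact boundaryless and
`dim F' = dim E + 1`, there is `ε > 0` such that `Θ(v, s) = f(v) + s ν(v)` is a `C^n` local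
diffeomorphism at every `(v, s)` with `|s| < ε` (injective differential between spaces of equal
finite dimension, and the inverse function theorem on manifolds,
`Literature.Geometry.Manifold.isLocalDiffeomorphAt_of_mfderiv`). [cite: Gromov1986, §2.1.3 (C) p. 57] -/
theorem exists_pos_forall_isLocalDiffeomorphAt_thickening [I.Boundaryless] [IsManifold I n V]
    [FiniteDimensional ℝ E] [FiniteDimensional ℝ F'] [CompactSpace V] {f ν : V → F'}
    (hf : ContMDiff I 𝓘(ℝ, F') n f) (hν : ContMDiff I 𝓘(ℝ, F') n ν) (hn : 1 ≤ n)
    (hfi : ∀ v, Injective (mfderiv I 𝓘(ℝ, F') f v))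
    (hνt : ∀ (v : V) (w : TangentSpace I v), mfderiv I 𝓘(ℝ, F') f v w ≠ ν v)
    (hdim : Module.finrank ℝ F' = Module.finrank ℝ E + 1) :
    ∃ ε > 0, ∀ q : V × ℝ, |q.2| < ε →
      IsLocalDiffeomorphAt (I.prod 𝓘(ℝ, ℝ)) 𝓘(ℝ, F') n
        (fun q : V × ℝ => f q.1 + q.2 • ν q.1) q := by
  haveI : CompleteSpace (E × ℝ) := FiniteDimensional.complete ℝ (E × ℝ)
  haveI : CompleteSpace F' := FiniteDimensional.complete ℝ F'
  have hn0 : n ≠ 0 := by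
    rintro rfl
    exact not_lt.2 hn zero_lt_one
  have hdim' : Module.finrank ℝ (E × ℝ) = Module.finrank ℝ F' := by
    rw [Module.finrank_prod, Module.finrank_self, hdim]
  obtain ⟨ε, hε, hinj⟩ := exists_pos_forall_injective_mfderiv_thickening hf hν hn hfi hνt
  refine ⟨ε, hε, fun q hq => ?_⟩
  -- the differential at `q`, read as a map `E × ℝ →L F'`, is a linear isomorphism
  let M : E × ℝ →L[ℝ] F' :=
    mfderiv (I.prod 𝓘(ℝ, ℝ)) 𝓘(ℝ, F') (fun q : V × ℝ => f q.1 + q.2 • ν q.1) q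
  have hMi : Injective M := hinj q hq
  let L : (E × ℝ) ≃L[ℝ] F' :=
    ((M : E × ℝ →ₗ[ℝ] F').linearEquivOfInjective hMi hdim').toContinuousLinearEquiv
  have hL : mfderiv (I.prod 𝓘(ℝ, ℝ)) 𝓘(ℝ, F') (fun q : V × ℝ => f q.1 + q.2 • ν q.1) q =
      (L : E × ℝ →L[ℝ] F') := by
    ext w
    rfl
  exact Literature.Geometry.Manifold.isLocalDiffeomorphAt_of_mfderiv hn0 isOpen_univ (mem_univ q)
    (contMDiff_thickening hf hν).contMDiffOn L hL

end Literature.Topology.Immersions
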